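import Mathlib
import HarnessLib

/-!
# `NoHeavyLowerTail` (crux stmt-CriticalPhenomena-4575), antithetic vdBHK programme: the Λ-COORDINATE FORM of the colouring poset (FACT of
# FINDING-AK-g45.md §1 / PROOF-CO-g46.md §0) as a kernel lemma

Support file (seat `prim-ineq-gen-7` gen 47; `--supports stmt-CriticalPhenomena-4575`).  No `sorry`, no definitions.
For colourings `s, t : E → Bool` (`true` = red) of a finite poset with strict down-sets `down e`, the programme's explicit colouring order
`κ(t) ⊆ κ(s) ∧ κ(s̄) ⊆ κ(t̄) ∧ (s ∖ t ⊆ κ(s) ∩ κ(t̄))` (red interior `κ(s) = {e : ↓e ⊆ red}`, blue interior `κ(s̄)`) holds iff every element's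
Λ-label (`0 = RI, 1 = RN, 2 = BN, 3 = BI`, hypothesis `hlab`) goes up in `Λ = {RI, BN} < {RN, BI}` (relation `leL` of `AntitheticCrownUniversal`).
This is the hypothesis `hle` under which `AntitheticCrownObstruction.crown_obstruction` (THEOREM CO for every finite poset) is stated.
* `AntitheticColouringOrder.label_order_iff` — the equivalence (a 64-case check per element).
-/

namespace Summit.CriticalPhenomena.PercolationContinuityZ3.Theorems

namespace AntitheticColouringOrder

variable {E : Type*} [Fintype E] [DecidableEq E]

/-- **The Λ-coordinate form of the colouring poset (FACT, FINDING-AK-g45 §1 / PROOF-CO-g46 §0).**  For colourings `s, t` of a finite poset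
(`true` = red; red interior `κ(s) = {e : ↓e ⊆ red}`, blue interior `κ(s̄)`), the programme's explicit order
`κ(t) ⊆ κ(s) ∧ κ(s̄) ⊆ κ(t̄) ∧ (s ∖ t ⊆ κ(s) ∩ κ(t̄))` holds iff every element's Λ-label goes up in `Λ = {RI, BN} < {RN, BI}`. [this work] -/
theorem label_order_iff
    (down : E → Finset E)
    (lab : (E → Bool) → E → ℕ)
    (hlab : ∀ s e, lab s e = if s e = true then (if ∀ d ∈ down e, s d = true then 0 else 1)
      else (if ∀ d ∈ down e, s d = false then 3 else 2))
    (leL : ℕ → ℕ → Bool)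
    (hleL : leL = fun p q => p == q || (p == 0 && q == 1) || (p == 0 && q == 3) || (p == 2 && q == 1) || (p == 2 && q == 3))
    (s t : E → Bool) :
    (∀ e, leL (lab s e) (lab t e) = true) ↔
      ((∀ e, (t e = true ∧ ∀ d ∈ down e, t d = true) → (s e = true ∧ ∀ d ∈ down e, s d = true)) ∧
       (∀ e, (s e = false ∧ ∀ d ∈ down e, s d = false) → (t e = false ∧ ∀ d ∈ down e, t d = false)) ∧
       (∀ e, s e = true → t e = false → ((∀ d ∈ down e, s d = true) ∧ (∀ d ∈ down e, t d = false)))) := by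
  have key : ∀ e, leL (lab s e) (lab t e) = true ↔
      (((t e = true ∧ ∀ d ∈ down e, t d = true) → (s e = true ∧ ∀ d ∈ down e, s d = true)) ∧
       ((s e = false ∧ ∀ d ∈ down e, s d = false) → (t e = false ∧ ∀ d ∈ down e, t d = false)) ∧
       (s e = true → t e = false → ((∀ d ∈ down e, s d = true) ∧ (∀ d ∈ down e, t d = false)))) := by
    intro e
    rw [hlab, hlab, hleL]
    by_cases p1 : (∀ d ∈ down e, s d = true) <;> by_cases p2 : (∀ d ∈ down e, s d = false) <;>
      by_cases q1 : (∀ d ∈ down e, t d = true) <;> by_cases q2 : (∀ d ∈ down e, t d = false) <;>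
      (first | simp only [eq_false p1] | simp only [eq_true p1]) <;>
      (first | simp only [eq_false p2] | simp only [eq_true p2]) <;>
      (first | simp only [eq_false q1] | simp only [eq_true q1]) <;>
      (first | simp only [eq_false q2] | simp only [eq_true q2]) <;>
      cases s e <;> cases t e <;> simp
  constructor
  · intro h
    exact ⟨fun e => ((key e).1 (h e)).1, fun e => ((key e).1 (h e)).2.1, fun e => ((key e).1 (h e)).2.2⟩
  · rintro ⟨h1, h2, h3⟩ e
    exact (key e).2 ⟨h1 e, h2 e, h3 e⟩

end AntitheticColouringOrder

end Summit.CriticalPhenomena.PercolationContinuityZ3.Theorems
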